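import Summits.Ventures.CertifiedManyBodySolver.Theorems.CovLa214M2bK1TierPHubS1
import Summits.Ventures.CertifiedManyBodySolver.Theorems.CovLa214M2bK2TierPS2Hub
import HarnessLib

/-!
# Ventures/CertifiedManyBodySolver — Theorems/La214M2bStiffnessBoxCeilingTierP.lean: the MO-S2 rung leaf «MOS2-la214-M2b» EDITION P — NO HYPOTHESES

Route `route-Ventures-CovLa214M2b` (route pen hubbard-m2-certneg-1; glue `Theses.CovLa214M2b.closes (h₁ : SegmentFanCeiling) (h₂ : TransportFanCeiling) :
Observables.La214M2b_StiffnessBoxCeiling`). EDITION P: both cruxes are now hypothesis-free kernel theorems — K1 `covLa214M2b_SegmentFanCeiling_tierP_hubS1`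
(stmt-Ventures-26183; tier-P pair {hub-Rm2-u′, S1′-Rm2-u″}, VERTEX kind, word 0.4172272, margin 0.0192415) and K2 `covLa214M2b_TransportFanCeiling_tierP_S2hub`
(stmt-Ventures-26184; pair {S2′-Rm2-u″, hub-Rm2-u′}, INTERIOR kind, word 0.4265107, margin 0.0099580), seat hubbard-cov-la214-unc-2 — so the rung leaf itself
is ONE hypothesis-free theorem in one FQN: `La214M2b_StiffnessBoxCeiling_tierP`. Seat `hubbard-cov-la214-box-1`
(«LA214E-BOXREAD» K1 desk, D-0154 (1)(C) COVERAGE La214; zero compute; glue only — every certificate replay, energy window, `D₄` symmetrisation, apex transport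
and torus → thermodynamic-limit passage is in the imported kernel theorems).
HONEST FRAMING (wording class (xx1)): a one-sided certified flux-STIFFNESS-scale CEILING `ρ_s(t′, U, 1) ≤ 0.4364687 = 0.98 × kinematic` on the DOWNFOLDED
SCREENING-GRADE one-band La₂CuO₄ parent box «La214-E» `[−3/10, −1/5] × [29/5, 74/5] × {n = 1}` (D-0150 M2(b)) = CONTROL / CALIBRATION + labelled heuristic
(print: La₂CuO₄ is an AF Mott insulator); a RUNG leaf (class rung, D-0061), never summit credit; a ceiling never speaks to `ρ_s = 0`, to the presence of
superconductivity, to `T_c` or to any phase; never «certified true negative/positive»; nothing here is a statement about La₂CuO₄ samples; no summit statement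
is proved by this file.
References: T. Koma, H. Tasaki, J. Stat. Phys. 76 (1994) 745, §1 [KomaTasaki1994]; D. J. Scalapino, S. R. White, S.-C. Zhang, PRB 47 (1993) 7995, §II
[ScalapinoWhiteZhang1993].
-/

namespace Summit.Ventures.CertifiedManyBodySolver.Theorems

open Summit.Ventures.CertifiedManyBodySolver.Theses.CovLa214M2b
open Summit.Ventures.CertifiedManyBodySolver.Observables Summit.Ventures.CertifiedManyBodySolver.Downfold

/-- **THE RUNG LEAF «MOS2-la214-M2b», EDITION P — NO HYPOTHESES**: `La214M2b_StiffnessBoxCeiling` (`ρ_s(t′, U, 1) ≤ 0.4364687` on `[−3/10, −1/5] × [29/5, 74/5]`)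
from the two hypothesis-free tier-P crux theorems by the route glue `closes`. CONTROL/CALIBRATION ceiling; not a statement about superconductivity.
[cite: KomaTasaki1994, §1] [cite: ScalapinoWhiteZhang1993, §II] -/
theorem La214M2b_StiffnessBoxCeiling_tierP : La214M2b_StiffnessBoxCeiling :=
  closes covLa214M2b_SegmentFanCeiling_tierP_hubS1 covLa214M2b_TransportFanCeiling_tierP_S2hub

end Summit.Ventures.CertifiedManyBodySolver.Theorems
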